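import Literature.Geometry.Lorentzian.KerrBoyerLindquistQuasiIsotropic
import Literature.Geometry.Lorentzian.DecaySymbolsLinear
import Literature.Geometry.Lorentzian.DecaySymbolsInverse
import HarnessLib

/-!
# The Boyer–Lindquist slice of Kerr in quasi-isotropic coordinates, V: Dafermos–Rodnianski decay
# of the metric

The Riemannian metric of the Boyer–Lindquist slice `{t = 0}` of Kerr, written in quasi-isotropic
Cartesian coordinates (`Kerr.Ingoing.blHRep`,
`h = (Σ/ρ²) δ + (a²(Σ + 2MR)/Σ) ϖ ⊗ ϖ`, `Σ = R² + a² x₃²/ρ²`, `R = ρ + M + (M² − a²)/(4ρ)`,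
`ϖ = (x₁dx₂ − x₂dx₁)/ρ²`), is packaged as a bilinear-form-valued map `blHRepCLM` and shown to be
**strongly asymptotically flat with mass `M` at the Dafermos–Rodnianski rate**:

  `h − (1 + 2M/ρ) δ = O₂(ρ⁻²)` (`isBigOSmooth_blHRepCLM_sub`),

in the symbol calculus `IsBigOSmooth` of `DecaySymbols.lean`. Ingredients: `Σ/ρ² − 1 − 2M/ρ =
(R² − ρ² − 2Mρ)/ρ² + a²x₃²/ρ⁴ = O₂(ρ⁻²)` (`qiRadius_sq_sub`: `R² − ρ² − 2Mρ = O₂(1)`); `Σ = O₂(ρ²)`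
is elliptic, `Σ ≥ ρ²/4` far out (`blSigma_lower`), so `1/Σ = O₂(ρ⁻²)` (`IsBigOSmooth.inv_of_elliptic`)
and the axial coefficient `a²(1 + 2MR/Σ) = O₂(1)`; and `ϖ ⊗ ϖ = O₂(ρ⁻²)` (coefficients `xᵢxⱼ/ρ⁴`).
This is the metric half of the admissibility of the (rest-frame) Kerr slice in the class of
Dafermos–Rodnianski, App. B.2.3 (`h = (1 + 2M/r)δ + o₂(r⁻¹)`, `k = o₁(r⁻²)`).

References: S. Brandt, E. Seidel, Phys. Rev. D 54 (1996) 1403, §II; M. Dafermos, I. Rodnianski,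
Clay lecture notes (2013), App. B.2.3; R. Bartnik, CPAM 39 (1986), Def. 2.1.
-/

noncomputable section

open Bundle TopologicalSpace Set Module Filter Asymptotics Bornology
open scoped InnerProductSpace Topology

namespace Literature.Geometry.Lorentzian

namespace Kerr.Ingoing

/-! ### The metric as a bilinear-form-valued map -/

/-- The coordinate tensor `dxᵢ ⊗ dxⱼ` on `E3` as a continuous bilinear form
(`(v, w) ↦ vᵢ wⱼ`). [folklore] -/
def coordTensor (i j : Fin 3) : E3 →L[ℝ] E3 →L[ℝ] ℝ :=
  (EuclideanSpace.proj i : E3 →L[ℝ] ℝ).smulRight (EuclideanSpace.proj j : E3 →L[ℝ] ℝ)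

/-- `(dxᵢ ⊗ dxⱼ)(v, w) = vᵢ wⱼ`. [folklore] -/
@[simp]
theorem coordTensor_apply (i j : Fin 3) (v w : E3) : coordTensor i j v w = v i * w j := rfl

/-- **The axial tensor `ϖ ⊗ ϖ`**, `ϖ = (x₁dx₂ − x₂dx₁)/ρ²`, as a continuous-bilinear-form-valued map,
expanded in coordinate tensors: `(x₁²dx₂² − x₁x₂(dx₂dx₁ + dx₁dx₂) + x₂²dx₁²)/ρ⁴`.
Brandt–Seidel 1996, §II. [cite: BrandtSeidel1996, §II] -/
def rotTensor (x : E3) : E3 →L[ℝ] E3 →L[ℝ] ℝ :=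
  (x 0 * x 0 / ‖x‖ ^ 4) • coordTensor 1 1 - (x 0 * x 1 / ‖x‖ ^ 4) • coordTensor 1 0 -
      (x 1 * x 0 / ‖x‖ ^ 4) • coordTensor 0 1 + (x 1 * x 1 / ‖x‖ ^ 4) • coordTensor 0 0

/-- `(ϖ ⊗ ϖ)(v, w) = ϖ(v) ϖ(w)`. [cite: BrandtSeidel1996, §II] -/
theorem rotTensor_apply (x v w : E3) : rotTensor x v w = rotForm x v * rotForm x w := by
  have h : rotTensor x v w = x 0 * x 0 / ‖x‖ ^ 4 * (v 1 * w 1) - x 0 * x 1 / ‖x‖ ^ 4 * (v 1 * w 0) -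
      x 1 * x 0 / ‖x‖ ^ 4 * (v 0 * w 1) + x 1 * x 1 / ‖x‖ ^ 4 * (v 0 * w 0) := rfl
  rw [h]
  unfold rotForm
  ring

/-- **The Boyer–Lindquist slice metric in quasi-isotropic Cartesian coordinates as a
bilinear-form-valued map**: `h_x = (Σ/ρ²) δ + (a²(Σ + 2MR)/Σ) ϖ ⊗ ϖ` with
`Σ = R(ρ)² + a² x₃²/ρ²`, `R = qiRadius M a ρ` (`blHRepCLM_apply`: its values are `blHRep`).
Brandt–Seidel 1996, §II. [cite: BrandtSeidel1996, §II] -/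
def blHRepCLM (M a : ℝ) (x : E3) : E3 →L[ℝ] E3 →L[ℝ] ℝ :=
  ((qiRadius M a ‖x‖ ^ 2 + a ^ 2 * (x 2 / ‖x‖) ^ 2) / ‖x‖ ^ 2) •
      (innerSL ℝ : E3 →L[ℝ] E3 →L[ℝ] ℝ) +
    (a ^ 2 * (qiRadius M a ‖x‖ ^ 2 + a ^ 2 * (x 2 / ‖x‖) ^ 2 + 2 * M * qiRadius M a ‖x‖) /
        (qiRadius M a ‖x‖ ^ 2 + a ^ 2 * (x 2 / ‖x‖) ^ 2)) • rotTensor x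

/-- The values of `blHRepCLM` are the metric coefficients `blHRep`. [cite: BrandtSeidel1996, §II] -/
theorem blHRepCLM_apply (M a : ℝ) (x v w : E3) : blHRepCLM M a x v w = blHRep M a x v w := by
  have h : blHRepCLM M a x v w =
      (qiRadius M a ‖x‖ ^ 2 + a ^ 2 * (x 2 / ‖x‖) ^ 2) / ‖x‖ ^ 2 * ⟪v, w⟫_ℝ +
        a ^ 2 * (qiRadius M a ‖x‖ ^ 2 + a ^ 2 * (x 2 / ‖x‖) ^ 2 + 2 * M * qiRadius M a ‖x‖) /
          (qiRadius M a ‖x‖ ^ 2 + a ^ 2 * (x 2 / ‖x‖) ^ 2) * rotTensor x v w := rfl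
  rw [h, rotTensor_apply]
  rfl

/-! ### Symbol estimates -/

/-- `ρ² = O₂(ρ²)` on `E3`. [folklore] -/
theorem isBigOSmooth_norm_sq : IsBigOSmooth 2 2 fun y : E3 ↦ ‖y‖ ^ 2 := by
  refine (((isBigOSmooth_two_apply_mul_apply (n := 3) 0 0).add
    (isBigOSmooth_two_apply_mul_apply 1 1)).add (isBigOSmooth_two_apply_mul_apply 2 2)).congr
    fun y ↦ ?_
  rw [EuclideanSpace.real_norm_sq_eq, Fin.sum_univ_three]
  ring

/-- `ρ = O₂(ρ)` on `E3` (`ρ = ρ² · ρ⁻¹` off the origin). [folklore] -/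
theorem isBigOSmooth_norm : IsBigOSmooth 2 1 fun y : E3 ↦ ‖y‖ := by
  have h := isBigOSmooth_norm_sq.mul (isBigOSmooth_inv_norm (E := E3))
  rw [show (2 : ℝ) + -1 = 1 by norm_num] at h
  refine h.congr_far (R₁ := 0) fun y hy ↦ ?_
  field_simp

/-- **The quasi-isotropic radius is a symbol of order one**: `R(ρ) = ρ + M + (M² − a²)/(4ρ) = O₂(ρ)`.
[cite: BrandtSeidel1996, §II] -/
theorem isBigOSmooth_qiRadius (M a : ℝ) : IsBigOSmooth 2 1 fun y : E3 ↦ qiRadius M a ‖y‖ := by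
  refine ((isBigOSmooth_norm.add ((isBigOSmooth_const 2 M).mono zero_le_one)).add
    (((isBigOSmooth_inv_norm (E := E3)).const_mul ((M ^ 2 - a ^ 2) / 4)).mono
      (by norm_num))).congr fun y ↦ ?_
  unfold qiRadius
  ring

/-- `cos²θ = x₃²/ρ² = O₂(1)`. [folklore] -/
theorem isBigOSmooth_latSq : IsBigOSmooth 2 0 fun y : E3 ↦ (y 2 / ‖y‖) ^ 2 := by
  have h := (isBigOSmooth_two_apply (n := 3) 2).mul (isBigOSmooth_inv_norm (E := E3))
  rw [show (1 : ℝ) + -1 = 0 by norm_num] at h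
  exact (h.pow 2).congr fun y ↦ by rw [div_eq_mul_inv]

/-- **`Σ = R² + a² cos²θ = O₂(ρ²)`**. [cite: BrandtSeidel1996, §II] -/
theorem isBigOSmooth_blSigma (M a : ℝ) :
    IsBigOSmooth 2 2 fun y : E3 ↦ qiRadius M a ‖y‖ ^ 2 + a ^ 2 * (y 2 / ‖y‖) ^ 2 := by
  have h := (isBigOSmooth_qiRadius M a).mul (isBigOSmooth_qiRadius M a)
  rw [show (1 : ℝ) + 1 = 2 by norm_num] at h
  exact (h.congr fun y ↦ (sq _).symm).add ((isBigOSmooth_latSq.const_mul (a ^ 2)).mono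
    (by norm_num))

/-- **Ellipticity of `Σ`**: `Σ ≥ R² ≥ ρ²/4` far out (`R ≥ ρ/2` once `ρ ≥ 1 + a² + 2|M|`).
[cite: BrandtSeidel1996, §II] -/
theorem blSigma_lower (M a : ℝ) : ∀ᶠ y in cobounded E3,
    1 / 4 * ‖y‖ ^ (2 : ℝ) ≤ qiRadius M a ‖y‖ ^ 2 + a ^ 2 * (y 2 / ‖y‖) ^ 2 := by
  filter_upwards [eventually_cobounded_le_norm (E := E3) (1 + a ^ 2 + 2 * |M|)] with y hy
  have ha : 0 ≤ a ^ 2 := sq_nonneg a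
  have hMabs : 0 ≤ |M| := abs_nonneg M
  have hMle : -|M| ≤ M := neg_abs_le M
  have hρ1 : 1 ≤ ‖y‖ := by linarith
  have hρ : 0 < ‖y‖ := by linarith
  have hR : ‖y‖ / 2 ≤ qiRadius M a ‖y‖ := by
    unfold qiRadius
    have h1 : -a ^ 2 / 4 ≤ (M ^ 2 - a ^ 2) / (4 * ‖y‖) := by
      rw [le_div_iff₀ (by positivity)]
      nlinarith [sq_nonneg M, mul_nonneg ha (by linarith : (0 : ℝ) ≤ ‖y‖ - 1)]
    linarith
  have hR0 : 0 ≤ ‖y‖ / 2 := by positivity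
  rw [Real.rpow_two]
  nlinarith [mul_le_mul hR hR hR0 (hR0.trans hR), mul_nonneg ha (sq_nonneg (y 2 / ‖y‖))]

/-- `Σ > 0` far out. [cite: BrandtSeidel1996, §II] -/
theorem blSigma_pos_far (M a : ℝ) : ∃ R₁ : ℝ, ∀ y : E3, R₁ < ‖y‖ →
    0 < qiRadius M a ‖y‖ ^ 2 + a ^ 2 * (y 2 / ‖y‖) ^ 2 := by
  obtain ⟨R₁, -, hR₁⟩ := (hasBasis_cobounded_norm (E := E3)).eventually_iff.1
    ((blSigma_lower M a).and (eventually_cobounded_lt_norm (E := E3) 0))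
  refine ⟨R₁, fun y hy ↦ ?_⟩
  obtain ⟨h1, h2⟩ := hR₁ (show y ∈ {x : E3 | R₁ ≤ ‖x‖} from hy.le)
  exact (mul_pos (by norm_num) (Real.rpow_pos_of_pos h2 2)).trans_le h1

/-- **`1/Σ = O₂(ρ⁻²)`** (inverse of an elliptic symbol). [cite: BrandtSeidel1996, §II] -/
theorem isBigOSmooth_blSigma_inv (M a : ℝ) :
    IsBigOSmooth 2 (-2) fun y : E3 ↦ (qiRadius M a ‖y‖ ^ 2 + a ^ 2 * (y 2 / ‖y‖) ^ 2)⁻¹ :=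
  (isBigOSmooth_blSigma M a).inv_of_elliptic (c := 1 / 4) (by norm_num) (blSigma_lower M a)

/-- **The axial coefficient `a²(Σ + 2MR)/Σ = a²(1 + 2MR/Σ)` is a symbol of order zero.**
[cite: BrandtSeidel1996, §II] -/
theorem isBigOSmooth_blAxialCoeff (M a : ℝ) : IsBigOSmooth 2 0 fun y : E3 ↦
    a ^ 2 * (qiRadius M a ‖y‖ ^ 2 + a ^ 2 * (y 2 / ‖y‖) ^ 2 + 2 * M * qiRadius M a ‖y‖) /
      (qiRadius M a ‖y‖ ^ 2 + a ^ 2 * (y 2 / ‖y‖) ^ 2) := by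
  have h := (isBigOSmooth_qiRadius M a).mul (isBigOSmooth_blSigma_inv M a)
  rw [show (1 : ℝ) + -2 = -1 by norm_num] at h
  have h1 : IsBigOSmooth 2 0 fun y : E3 ↦ a ^ 2 * (1 + 2 * M * (qiRadius M a ‖y‖ *
      (qiRadius M a ‖y‖ ^ 2 + a ^ 2 * (y 2 / ‖y‖) ^ 2)⁻¹)) :=
    ((isBigOSmooth_const 2 (1 : ℝ)).add ((h.const_mul (2 * M)).mono (by norm_num))).const_mul
      (a ^ 2)
  obtain ⟨R₁, hR₁⟩ := blSigma_pos_far M a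
  refine h1.congr_far (R₁ := R₁) fun y hy ↦ ?_
  have hS := (hR₁ y hy).ne'
  set S := qiRadius M a ‖y‖ ^ 2 + a ^ 2 * (y 2 / ‖y‖) ^ 2 with hSdef
  field_simp

/-- **The axial tensor is a symbol of order `−2`**: `ϖ ⊗ ϖ = O₂(ρ⁻²)` (coefficients `xᵢxⱼ/ρ⁴`).
[cite: BrandtSeidel1996, §II] -/
theorem isBigOSmooth_rotTensor : IsBigOSmooth 2 (-2) fun y : E3 ↦ rotTensor y :=
  ((((isBigOSmooth_two_apply_mul_apply_div_norm_pow_four (n := 3) 0 0).smul_const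
    (coordTensor 1 1)).sub
    ((isBigOSmooth_two_apply_mul_apply_div_norm_pow_four (n := 3) 0 1).smul_const
      (coordTensor 1 0))).sub
    ((isBigOSmooth_two_apply_mul_apply_div_norm_pow_four (n := 3) 1 0).smul_const
      (coordTensor 0 1))).add
    ((isBigOSmooth_two_apply_mul_apply_div_norm_pow_four (n := 3) 1 1).smul_const
      (coordTensor 0 0))

/-- **The conformal coefficient minus the Schwarzschildean part decays**:
`Σ/ρ² − (1 + 2M/ρ) = (R² − ρ² − 2Mρ)/ρ² + a²x₃²/ρ⁴ = O₂(ρ⁻²)` (`qiRadius_sq_sub`).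
[cite: BrandtSeidel1996, §II] -/
theorem isBigOSmooth_blConformal_sub (M a : ℝ) : IsBigOSmooth 2 (-2) fun y : E3 ↦
    (qiRadius M a ‖y‖ ^ 2 + a ^ 2 * (y 2 / ‖y‖) ^ 2) / ‖y‖ ^ 2 - (1 + 2 * M / ‖y‖) := by
  have hi := isBigOSmooth_inv_norm (E := E3)
  have hi2 : IsBigOSmooth 2 (-2) fun y : E3 ↦ ‖y‖⁻¹ * ‖y‖⁻¹ := by
    have h := hi.mul hi
    rw [show (-1 : ℝ) + -1 = -2 by norm_num] at h
    exact h
  have hE : IsBigOSmooth 2 0 fun y : E3 ↦ (3 * M ^ 2 - a ^ 2) / 2 +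
      M * (M ^ 2 - a ^ 2) / 2 * ‖y‖⁻¹ + (M ^ 2 - a ^ 2) ^ 2 / 16 * (‖y‖⁻¹ * ‖y‖⁻¹) :=
    ((isBigOSmooth_const 2 _).add ((hi.const_mul _).mono (by norm_num))).add
      ((hi2.const_mul _).mono (by norm_num))
  have h1 := hE.mul hi2
  rw [show (0 : ℝ) + -2 = -2 by norm_num] at h1
  refine (h1.add ((isBigOSmooth_two_apply_mul_apply_div_norm_pow_four (n := 3) 2 2).const_mul
    (a ^ 2))).congr_far (R₁ := 0) fun y hy ↦ ?_
  have hρ : ‖y‖ ≠ 0 := hy.ne'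
  unfold qiRadius
  field_simp
  ring

/-- **Dafermos–Rodnianski decay of the Boyer–Lindquist slice metric**: in quasi-isotropic Cartesian
coordinates `h − (1 + 2M/ρ) δ = O₂(ρ⁻²)` as a bilinear-form-valued smooth symbol (hence
`= o₂(ρ⁻¹)`, the metric half of Dafermos–Rodnianski admissibility with mass `M`). Brandt–Seidel
1996, §II; Dafermos–Rodnianski 2013, App. B.2.3. [cite: BrandtSeidel1996, §II] -/
theorem isBigOSmooth_blHRepCLM_sub (M a : ℝ) : IsBigOSmooth 2 (-2) fun y : E3 ↦
    blHRepCLM M a y - (1 + 2 * M / ‖y‖) • (innerSL ℝ : E3 →L[ℝ] E3 →L[ℝ] ℝ) := by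
  have h2 : IsBigOSmooth 2 (-2) fun y : E3 ↦
      (a ^ 2 * (qiRadius M a ‖y‖ ^ 2 + a ^ 2 * (y 2 / ‖y‖) ^ 2 + 2 * M * qiRadius M a ‖y‖) /
        (qiRadius M a ‖y‖ ^ 2 + a ^ 2 * (y 2 / ‖y‖) ^ 2)) • rotTensor y := by
    have h := (isBigOSmooth_blAxialCoeff M a).smul isBigOSmooth_rotTensor
    rw [show (0 : ℝ) + -2 = -2 by norm_num] at h
    exact h
  refine (((isBigOSmooth_blConformal_sub M a).smul_const
    (innerSL ℝ : E3 →L[ℝ] E3 →L[ℝ] ℝ)).add h2).congr fun y ↦ ?_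
  simp only [blHRepCLM]
  rw [sub_smul]
  abel

end Kerr.Ingoing

end Literature.Geometry.Lorentzian

end
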